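import Summits.QuantumFields.YangMills.Theorems.BalabanUVNodesN07RoadBHregChi29AxOfRecord
import Summits.QuantumFields.YangMills.Theorems.BalabanUVNodesN09RegularityTowerSelOfThm1OfNumerics

/-!
# BalabanUVNodes ∕ N07–N09 junction — THE REGULARITY TOWER OF ROAD B FOR THE RE-CENTRED β-INPUT OF RECORD (`chiFixed29Ax` over `TcanOfRecord`, the (2.9) cut-off at RC-1's
# NAMED `critCfgAxOfRecord`): by induction on the step, `A_j` continuous on every `domAlt_j`, `hreg_j` and (F3)_j for all `j < K` — from [B11] Thm 1's two-radii binders,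
# NUMERICS, and the (H-U)∕(I19) rows of the Ax β-input (the Ax twin of dag-n09-w2 g5's `…N09RegularityTowerSelOfThm1OfNumerics`; what the Sel offer closes outright, the Ax
# record closes modulo measurability — this seat's located line)

Cell `pub-ymgap` (YM-PLAN Track A, D-0062), width seat `pub-ymgap-dag-n07-w3` (g22; node N07 = [Balaban1985Variational] ∕ K0–K1 junction).  `--kind proof --supports
stmt-QuantumFields-27239 --as helper` (K1ᴬ `StabilityBRunRowsAtRecordR13SepCoPHVAx`, the live re-centred deciding crux since route rev 31∕32; K1⁹ 27364 is its aside), COUNT-NEUTRAL.  NEW leaf; THEOREMS ONLY — 0 `def`, 0 `sorry`, 0 `instance`, 0 `notation`; standard axioms.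
[I] = [Balaban1987RG1] (CMP 109), [B7] = [Balaban1985Averaging] (CMP 98), [B11] = [Balaban1985Variational] (CMP 102).

WHY.  File 2 of this seat (`…N07RoadBHregChi29AxOfRecord.regularOn_domAlt_betaInput_chi29Ax_of_thm1_of_reg8`) closes ONE STEP of road B for the Ax β-input
`ρ_k^{Ax} = χ^{(2.9)}_{k,ax}·exp[−GF_k∕g_k² + A_k]` given the step's input `hA : ContinuousOn A_k domAlt_k`; as in dag-n09-w2 g5's Sel tower that input is the previous step's OUTPUT once
(F3)_k holds, and (F3)_k comes from LOCAL data at the witness `V^{(k)}_{ax}(V)`: it lies in the fibre over `V` (PT-A-2's `avg_critCfgAxOfRecord`), every axial-centred fluctuation variable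
vanishes there (so `χ^{(2.9)}_{k,ax} = 1`, `ρ_k^{Ax} > 0`), it lies in the interior of the local support set (file 2's `hρK_betaInput_chi29Ax_of_hsol_of_numerics`) hence in the loop guard, and
`ρ_k^{Ax}` is continuous at it (file 2's `hρc_…` fed by file 1's continuity of the named letter).  So the induction runs exactly as for the offer — EXCEPT that (H-U) `Measurable ρ_j^{Ax}` and
(I19) `Integrable ρ_j^{Ax}`, theorems for `UkSel`, are DISPLAYED level families here (file 1 §5: theorems only under orbit-uniqueness at every coarse field).
* §1 `betaInput_chi29Ax_critCfgAx_pos` (the witness carries positive density), ★★ `hregAx_pos_contA_of_thm1_of_numerics` (THE STEP: IH `ContinuousOn A_k domAlt_k` ⟹ `hreg_k` ∧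
  `HasContTransportOn` ∧ (F3)_k ∧ `ContinuousOn A_{k+1} domAlt_{k+1}`), ★★★ `continuousOn_effActionHT_chi29Ax_all_of_thm1_of_numerics` (THE TOWER, `∀ j ≤ K`),
  ★★★ `hregAx_pos_all_of_thm1_of_numerics` (`∀ j < K`: `hreg_j` ∧ `HasContTransportOn` ∧ (F3)_j).
DISPLAYED (never asserted): [B11] Thm 1 at two radii on the domains (`h11`, `hreg8` — N07's); (H-U) `hρm` and (I19) `hint` for the Ax β-input at every level `j < K`; the SAME numerics
as the Sel tower (`0 < ε₁`; loop guard `α ≤ 1∕24`, `α < δ_N`, `157α < L^{1−d}`, `(ℓ²∕4)·B < α`; [B7] on `εreg`; the rider's two; STRICT `B < ε₀`; `εreg < εbg`, `εreg < α₀` with [B7]∕guard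
numerics on `α₀`; `0 ≤ ε₀`, `((dL)²∕4)·ε₀ < δ_Fed`) — the Federbush letter for the named letter's continuity, `((dL)²∕4)·(2εreg∕L²) < δ_Fed`, FOLLOWS from the strict `B < ε₀` row.

HONEST FRAMING (binding).  Composition BY NAME (dag-n09-w1∕w2∕w3∕w4 theorems, PT-A-2's names, this seat's files 1–2); NOTHING of Bałaban's asserted; `hreg`∕(F3)∕`contTOn` for the Ax
record NOT discharged (the two-radii binders, (H-U), (I19) stay displayed); no body of record edited, no name re-pointed; N07 ∕ N09 NOT discharged; K0⁷ ∕ K1⁹ ∕ K3⁸ and the unborn K-Ax texts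
NOT closed; counts unmoved (8∕28 · K 1∕4); R4 = the CONDITIONAL finite-𝕋⁴ rung `BalabanLadder.UV` only — NOT continuum ∕ ℝ⁴ ∕ OS; the Yang–Mills mass gap (Clay) is NOT proved by any of this.
-/

noncomputable section

open Filter Topology Set Function MeasureTheory

namespace Summit.QuantumFields.YangMills.BalabanUVNodes.N07RegularityTowerChi29AxOfThm1

open Literature.MathematicalPhysics.QuantumFieldTheory.Balaban1983to89
open Literature.MathematicalPhysics.QuantumFieldTheory.Balaban1983to89.Node00
open Literature.MathematicalPhysics.QuantumFieldTheory.Balaban1983to89.T4Continuum (T4Family)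
open Literature.MathematicalPhysics.QuantumFieldTheory.Balaban1983to89.BlockAveraging (Small Idx loopHol)
open Literature.MathematicalPhysics.QuantumFieldTheory.Balaban1983to89.BlockAveragingHaarAC (centralBond)
open Literature.MathematicalPhysics.QuantumFieldTheory.Balaban1983to89.ExpMeanLog (expMeanLogSU deltaSU deltaSU_pos)
open Literature.MathematicalPhysics.QuantumFieldTheory.Balaban1983to89.FederbushMean (deltaFed deltaFed_pos)
open Literature.MathematicalPhysics.QuantumFieldTheory.Balaban1983to89.B12ContinuousTransportInvarianceOn (isOpen_domAltOfRecord)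
open Summit.QuantumFields.YangMills.BalabanUVNodes.N07RoadBHregChi29AxOfRecord
  (betaInput_chi29Ax_nonneg hρK_betaInput_chi29Ax_of_hsol_of_numerics hρc_betaInput_chi29Ax_local_of_continuousOn_crit regularOn_domAlt_betaInput_chi29Ax_of_thm1_of_reg8)
open Summit.QuantumFields.YangMills.BalabanUVNodes.N07CritCfgAxOfRecordClauses (continuousOn_critCfgAxOfRecord_of_thm1_of_reg8)
open Summit.QuantumFields.YangMills.BalabanUVNodes.N09LocalSupportSetAtRecord (localSupportSet_subset_loopGuard plaqSmall_of_mem_of_lt)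
open Summit.QuantumFields.YangMills.BalabanUVNodes.N09BackgroundRadiiTransfer (ukExists_εreg_of_h11_of_reg8)
open Summit.QuantumFields.YangMills.BalabanUVNodes.N09GaugeFixingTermContinuousOnAdmissible (continuousOn_gfOfRecord_domAlt)
open Summit.QuantumFields.YangMills.BalabanUVNodes.N09TransportPositiveOnDomainOfFibredChart (continuousOn_effActionHT_succ_of_subset_regSetOfRecord_of_pos)
open Summit.QuantumFields.YangMills.BalabanUVNodes.N09FibreIntegralContinuousOfChartRegularity (continuousOn_effActionHT_zero)
open Summit.QuantumFields.YangMills.BalabanUVNodes.N09TransportPositiveOfLocalRoute (TcanOfRecord_pos_of_localRoute_of_avg_eq)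

variable {F : T4Family} {N : ℕ} [NeZero N]

section Tower

variable (ν : Stage7Numerics) (εbg : ℝ) (K : ℕ) (g : ℕ → ℝ) {ε₁ : ℝ}

/-- **THE WITNESS CARRIES POSITIVE DENSITY (Ax edition)**: for `k + 1 ≤ m + K`, `V` solvable at `εreg` and `0 < ε₁`, every axial-centred fluctuation variable of `V^{(k)}_{ax}(V)` vanishes
(it lies in the fibre over `V`, PT-A-2's `avg_critCfgAxOfRecord`), so `χ^{(2.9)}_{k,ax} = 1` there and `ρ_k^{Ax}(V^{(k)}_{ax}(V)) > 0` (any transport `T`).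
[cite: Balaban1987RG1, (2.3) p.265, (2.9) p.266 and (0.19) p.255] -/
theorem betaInput_chi29Ax_critCfgAx_pos (hε1 : 0 < ε₁) (T : Transport F N) {k : ℕ} (hk1 : k + 1 ≤ (F.P K).m + (F.P K).K)
    {V : GaugeField (F.P K) (k + 1) (SU N)} (hsol : UkExists F N K (k + 1) ν.εreg V) :
    (∀ b : PBond (F.P K) k, fluctDevAxOfRecord F N ν K k (critCfgAxOfRecord F N ν K k V) b = 0) ∧
      0 < betaInputOfRecord F N T (chiFixed29Ax F N ν ε₁) K g k (critCfgAxOfRecord F N ν K k V) := by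
  have h0 : ∀ b : PBond (F.P K) k, fluctDevAxOfRecord F N ν K k (critCfgAxOfRecord F N ν K k V) b = 0 := fun b => by
    rw [fluctDevAxOfRecord_apply, avg_critCfgAxOfRecord hk1 hsol, inv_mul_cancel, GaugeGroup.dist1_one]
  have hχ : chiFix29AxOfRecord F N ν ε₁ K k (critCfgAxOfRecord F N ν K k V) = 1 :=
    (chiFix29AxOfRecord_eq_one_iff ν ε₁ K k _).2 fun b _ => by rw [h0 b]; exact hε1
  have e : betaInputOfRecord F N T (chiFixed29Ax F N ν ε₁) K g k (critCfgAxOfRecord F N ν K k V) =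
      chiFix29AxOfRecord F N ν ε₁ K k (critCfgAxOfRecord F N ν K k V) *
        Real.exp (-(1 / (g k) ^ 2) * gfOfRecord F N K k (critCfgAxOfRecord F N ν K k V) +
          effActionHT F N T (chiFixed29Ax F N ν ε₁) K g k (critCfgAxOfRecord F N ν K k V)) := rfl
  refine ⟨h0, ?_⟩
  rw [e, hχ, one_mul]
  exact Real.exp_pos _

omit [NeZero N] in
/-- The Federbush letter for the named letter's continuity follows from the strict threshold ordering and the `GF`-letter: `((dL)²∕4)·(2εreg∕L²) ≤ ((dL)²∕4)·ε₀ < δ_Fed`.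
[cite: Balaban1987RG1, (0.11) p.253 and p.259 (bookkeeping)] -/
theorem fed_of_hord_of_hGFnum (hε1 : 0 ≤ ε₁)
    (hord : 2 * ν.εreg / ((F.P K).L : ℝ) ^ 2 + 4 * max ε₁ (10 * (((((F.P K).d + 2) * (F.P K).L : ℕ) : ℝ) * ε₁) * ((F.P K).L : ℝ) ^ ((F.P K).d - 1)) < ν.ε₀)
    (hGFnum : ((((F.P K).d * (F.P K).L : ℕ) : ℝ)) ^ 2 / 4 * ν.ε₀ < deltaFed (Fin N)) :
    ((((F.P K).d * (F.P K).L : ℕ) : ℝ)) ^ 2 / 4 * (2 * ν.εreg / ((F.P K).L : ℝ) ^ 2) < deltaFed (Fin N) := by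
  have hmax : 0 ≤ 4 * max ε₁ (10 * (((((F.P K).d + 2) * (F.P K).L : ℕ) : ℝ) * ε₁) * ((F.P K).L : ℝ) ^ ((F.P K).d - 1)) :=
    mul_nonneg (by norm_num) (le_max_of_le_left hε1)
  have hle : 2 * ν.εreg / ((F.P K).L : ℝ) ^ 2 ≤ ν.ε₀ := by linarith
  have hc : 0 ≤ ((((F.P K).d * (F.P K).L : ℕ) : ℝ)) ^ 2 / 4 := by positivity
  exact (mul_le_mul_of_nonneg_left hle hc).trans_lt hGFnum

/-- ★★ **THE STEP ON THE LOCAL ROUTE FOR THE Ax RECORD** (`T = TcanOfRecord`, `χ = chiFixed29Ax ν ε₁`, `k < K`): from the induction hypothesis `ContinuousOn A_k domAlt_k`, [B11] Thm 1's two-radii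
binders, the (H-U)∕(I19) rows at level `k` and numerics — **`hreg_k` ∧ `HasContTransportOn`** (file 2), **(F3)_k** (dag-n09-w2's `TcanOfRecord_pos_of_localRoute_of_avg_eq` at the witness
`V^{(k)}_{ax}(V)`), and **`ContinuousOn A_{k+1} domAlt_{k+1}`** (dag-n09-w1 g5's corner). [cite: Balaban1987RG1, (0.19) p.255, p.259, (2.3) p.265, (2.9) p.266 and (2.10) p.267; Balaban1985Variational, Thm 1 (8) p.279] -/
theorem hregAx_pos_contA_of_thm1_of_numerics {k : ℕ} (hk : k < K)
    (hε1 : 0 < ε₁) {α : ℝ} (hα24 : α ≤ 1 / 24) (hαδ : α < deltaSU (Fin N)) (hαL : 157 * α < (((F.P K).L : ℝ) ^ ((F.P K).d - 1))⁻¹)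
    (hεreg : 0 < ν.εreg)
    (hε3 : (143 * (((((F.P K).d + 4 : ℕ) : ℝ)) ^ 2 / 4) ^ 2) * ν.εreg ≤ 1 / 3)
    (hε2 : 2 * ν.εreg ≤ 2 * deltaSU (Fin N) / ((((F.P K).d + 4) * (F.P K).L : ℕ) : ℝ) ^ 2)
    (hn1 : 1640 * (2 * (((((F.P K).d + 2) * (F.P K).L : ℕ) : ℝ) * ε₁) + ((((F.P K).d + 2) * (F.P K).L : ℕ) : ℝ) ^ 2 / 4 * (2 * ν.εreg / ((F.P K).L : ℝ) ^ 2)) *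
      (((F.P K).L : ℝ) ^ ((F.P K).d - 1)) ^ 2 ≤ 1)
    (hn2 : 13 * (2 * (((((F.P K).d + 2) * (F.P K).L : ℕ) : ℝ) * ε₁) + ((((F.P K).d + 2) * (F.P K).L : ℕ) : ℝ) ^ 2 / 4 * (2 * ν.εreg / ((F.P K).L : ℝ) ^ 2)) *
      ((F.P K).L : ℝ) ^ ((F.P K).d - 1) < deltaSU (Fin N))
    (hαB : ((((F.P K).d + 2) * (F.P K).L : ℕ) : ℝ) ^ 2 / 4 *
      (2 * ν.εreg / ((F.P K).L : ℝ) ^ 2 + 4 * max ε₁ (10 * (((((F.P K).d + 2) * (F.P K).L : ℕ) : ℝ) * ε₁) * ((F.P K).L : ℝ) ^ ((F.P K).d - 1))) < α)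
    (hord : 2 * ν.εreg / ((F.P K).L : ℝ) ^ 2 + 4 * max ε₁ (10 * (((((F.P K).d + 2) * (F.P K).L : ℕ) : ℝ) * ε₁) * ((F.P K).L : ℝ) ^ ((F.P K).d - 1)) < ν.ε₀)
    {α₀ : ℝ} (hlt : ν.εreg < εbg) (he : ν.εreg < α₀) (hα0 : 0 < α₀)
    (hα3 : (143 * (((((F.P K).d + 4 : ℕ) : ℝ)) ^ 2 / 4) ^ 2) * α₀ ≤ 1 / 3)
    (hα2 : 2 * α₀ ≤ 2 * deltaSU (Fin N) / ((((F.P K).d + 4) * (F.P K).L : ℕ) : ℝ) ^ 2)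
    (hα24' : ((((F.P K).d + 2) * (F.P K).L : ℕ) : ℝ) ^ 2 / 4 * (2 * α₀) ≤ 1 / 24)
    (hαL' : 157 * (((((F.P K).d + 2) * (F.P K).L : ℕ) : ℝ) ^ 2 / 4 * (2 * α₀)) < (((F.P K).L : ℝ) ^ ((F.P K).d - 1))⁻¹)
    (hε₀ : 0 ≤ ν.ε₀) (hGFnum : ((((F.P K).d * (F.P K).L : ℕ) : ℝ)) ^ 2 / 4 * ν.ε₀ < deltaFed (Fin N))
    (h11 : ∀ j, j ≤ K → ∀ V ∈ domAltOfRecord F N ν K j, UkExists F N K j εbg V ∧ UniqueUkOrbit F N K j εbg V)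
    (hreg8 : ∀ j, j ≤ K → ∀ V ∈ domAltOfRecord F N ν K j, Uk F N K j εbg V ∈ bgReg F N K j ν.εreg)
    (hρm : Measurable (betaInputOfRecord F N (TcanOfRecord F N) (chiFixed29Ax F N ν ε₁) K g k))
    (hint : Integrable (betaInputOfRecord F N (TcanOfRecord F N) (chiFixed29Ax F N ν ε₁) K g k) (fieldMeasure (F.P K) k (SU N)))
    (hA : ContinuousOn (effActionHT F N (TcanOfRecord F N) (chiFixed29Ax F N ν ε₁) K g k) (domAltOfRecord F N ν K k)) :
    (domAltOfRecord F N ν K (k + 1) ⊆ regSetOfRecord F N K k (betaInputOfRecord F N (TcanOfRecord F N) (chiFixed29Ax F N ν ε₁) K g k) ∧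
      HasContTransportOn F N K k (betaInputOfRecord F N (TcanOfRecord F N) (chiFixed29Ax F N ν ε₁) K g k) (domAltOfRecord F N ν K (k + 1))) ∧
      (∀ V ∈ domAltOfRecord F N ν K (k + 1), 0 < TcanOfRecord F N K k (betaInputOfRecord F N (TcanOfRecord F N) (chiFixed29Ax F N ν ε₁) K g k) V) ∧
      ContinuousOn (effActionHT F N (TcanOfRecord F N) (chiFixed29Ax F N ν ε₁) K g (k + 1)) (domAltOfRecord F N ν K (k + 1)) := by
  have hk1 : k + 1 ≤ (F.P K).m + (F.P K).K := by simp only [T4Continuum.T4Family.P_K]; omega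
  have hL0 : (0 : ℝ) < (F.P K).L := by exact_mod_cast (F.P K).L_pos
  have hDk := isOpen_domAltOfRecord (F := F) (N := N) ν K k
  have hDk1 := isOpen_domAltOfRecord (F := F) (N := N) ν K (k + 1)
  have hGF : ContinuousOn (gfOfRecord F N K k) (domAltOfRecord F N ν K k) := continuousOn_gfOfRecord_domAlt ν hk1 hε₀ hGFnum
  have hfed := fed_of_hord_of_hGFnum (F := F) (N := N) ν K hε1.le hord hGFnum
  have hregpair := regularOn_domAlt_betaInput_chi29Ax_of_thm1_of_reg8 ν ε₁ K g (TcanOfRecord F N) hk hεreg hε3 hε2 hε1 hn1 hn2 hαB hα24 hαδ hαL hord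
    hlt he hα0 hα3 hα2 hα24' hαL' hfed hρm hint (h11 (k + 1) hk) (hreg8 (k + 1) hk) hGF hA
  -- the by-name suppliers of (F3)_k at the witness `V^{(k)}_{ax}(V)`
  have hsolν : ∀ W ∈ domAltOfRecord F N ν K (k + 1), UkExists F N K (k + 1) ν.εreg W := ukExists_εreg_of_h11_of_reg8 ν εbg K h11 hreg8 hlt.le k hk
  have hcrit : ContinuousOn (critCfgAxOfRecord F N ν K k) (domAltOfRecord F N ν K (k + 1)) :=
    continuousOn_critCfgAxOfRecord_of_thm1_of_reg8 ν hk hlt he hα0 hα3 hα2 hα24' hαL' hεreg hε3 hε2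
      (by rw [div_mul_cancel₀ _ (by positivity)]) hfed (h11 (k + 1) hk) (hreg8 (k + 1) hk)
  have hK₀D : {W : GaugeField (F.P K) k (SU N) | (∀ c i, dist1 (loopHol W c i) ≤ α) ∧ ∀ p, dist1 (GaugeField.plaqHol W p) ≤
      2 * ν.εreg / ((F.P K).L : ℝ) ^ 2 + 4 * max ε₁ (10 * (((((F.P K).d + 2) * (F.P K).L : ℕ) : ℝ) * ε₁) * ((F.P K).L : ℝ) ^ ((F.P K).d - 1))} ⊆
      domAltOfRecord F N ν K k :=
    fun W hW => (mem_domAltOfRecord_iff F N ν K k W).2 (plaqSmall_of_mem_of_lt hord W hW)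
  have hρcK := hρc_betaInput_chi29Ax_local_of_continuousOn_crit ν ε₁ (TcanOfRecord F N) g hDk1 hDk hK₀D hαδ
    (localSupportSet_subset_loopGuard (F := F) (N := N) K k) hcrit hGF hA
  have hpos : ∀ V ∈ domAltOfRecord F N ν K (k + 1), 0 < TcanOfRecord F N K k (betaInputOfRecord F N (TcanOfRecord F N) (chiFixed29Ax F N ν ε₁) K g k) V := by
    intro V hV
    have hsol := hsolν V hV
    have havg : (avOfRecord F N K k).avg (critCfgAxOfRecord F N ν K k V) = V := avg_critCfgAxOfRecord hk1 hsol
    obtain ⟨h0, hρpos⟩ := betaInput_chi29Ax_critCfgAx_pos ν K g hε1 (TcanOfRecord F N) hk1 hsol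
    have havgD : (avOfRecord F N K k).avg (critCfgAxOfRecord F N ν K k V) ∈ domAltOfRecord F N ν K (k + 1) := by rw [havg]; exact hV
    -- the witness lies in the interior of the local support set, hence in the loop guard (and in `domAlt_k`)
    have hmem := interior_subset (hρK_betaInput_chi29Ax_of_hsol_of_numerics ν hk (TcanOfRecord F N) g hε1.le hεreg hε3 hε2 hn1 hn2 hαB hsolν
      (critCfgAxOfRecord F N ν K k V) havgD hρpos.ne')
    have hUα : ∀ c (i : Idx (F.P K)), dist1 (loopHol (critCfgAxOfRecord F N ν K k V) c i) ≤ α :=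
      localSupportSet_subset_loopGuard (F := F) (N := N) K k _ hmem
    exact TcanOfRecord_pos_of_localRoute_of_avg_eq hk hα24 hαδ hαL hρm (betaInput_chi29Ax_nonneg ν ε₁ (TcanOfRecord F N) K g k) hint havg hUα
      (hρcK _ hmem havgD fun b _ => by rw [h0 b]; exact hε1.ne) hρpos (hregpair.1 hV)
  exact ⟨hregpair, hpos, continuousOn_effActionHT_succ_of_subset_regSetOfRecord_of_pos (chiFixed29Ax F N ν ε₁) K g k hregpair.1 hpos⟩

/-- ★★★ **THE TOWER ON THE LOCAL ROUTE FOR THE Ax RECORD: `A_j` IS CONTINUOUS ON `domAlt_j` FOR EVERY `j ≤ K`** — from [B11] Thm 1's two-radii binders, the (H-U)∕(I19) level families and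
numerics (induction: base `continuousOn_effActionHT_zero`, step `hregAx_pos_contA_of_thm1_of_numerics`).
[cite: Balaban1987RG1, (0.17)–(0.19) p.255, p.259, (2.9) p.266 and (2.10) p.267; Balaban1985Variational, Thm 1 (8) p.279] -/
theorem continuousOn_effActionHT_chi29Ax_all_of_thm1_of_numerics
    (hε1 : 0 < ε₁) {α : ℝ} (hα24 : α ≤ 1 / 24) (hαδ : α < deltaSU (Fin N)) (hαL : 157 * α < (((F.P K).L : ℝ) ^ ((F.P K).d - 1))⁻¹)
    (hεreg : 0 < ν.εreg)
    (hε3 : (143 * (((((F.P K).d + 4 : ℕ) : ℝ)) ^ 2 / 4) ^ 2) * ν.εreg ≤ 1 / 3)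
    (hε2 : 2 * ν.εreg ≤ 2 * deltaSU (Fin N) / ((((F.P K).d + 4) * (F.P K).L : ℕ) : ℝ) ^ 2)
    (hn1 : 1640 * (2 * (((((F.P K).d + 2) * (F.P K).L : ℕ) : ℝ) * ε₁) + ((((F.P K).d + 2) * (F.P K).L : ℕ) : ℝ) ^ 2 / 4 * (2 * ν.εreg / ((F.P K).L : ℝ) ^ 2)) *
      (((F.P K).L : ℝ) ^ ((F.P K).d - 1)) ^ 2 ≤ 1)
    (hn2 : 13 * (2 * (((((F.P K).d + 2) * (F.P K).L : ℕ) : ℝ) * ε₁) + ((((F.P K).d + 2) * (F.P K).L : ℕ) : ℝ) ^ 2 / 4 * (2 * ν.εreg / ((F.P K).L : ℝ) ^ 2)) *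
      ((F.P K).L : ℝ) ^ ((F.P K).d - 1) < deltaSU (Fin N))
    (hαB : ((((F.P K).d + 2) * (F.P K).L : ℕ) : ℝ) ^ 2 / 4 *
      (2 * ν.εreg / ((F.P K).L : ℝ) ^ 2 + 4 * max ε₁ (10 * (((((F.P K).d + 2) * (F.P K).L : ℕ) : ℝ) * ε₁) * ((F.P K).L : ℝ) ^ ((F.P K).d - 1))) < α)
    (hord : 2 * ν.εreg / ((F.P K).L : ℝ) ^ 2 + 4 * max ε₁ (10 * (((((F.P K).d + 2) * (F.P K).L : ℕ) : ℝ) * ε₁) * ((F.P K).L : ℝ) ^ ((F.P K).d - 1)) < ν.ε₀)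
    {α₀ : ℝ} (hlt : ν.εreg < εbg) (he : ν.εreg < α₀) (hα0 : 0 < α₀)
    (hα3 : (143 * (((((F.P K).d + 4 : ℕ) : ℝ)) ^ 2 / 4) ^ 2) * α₀ ≤ 1 / 3)
    (hα2 : 2 * α₀ ≤ 2 * deltaSU (Fin N) / ((((F.P K).d + 4) * (F.P K).L : ℕ) : ℝ) ^ 2)
    (hα24' : ((((F.P K).d + 2) * (F.P K).L : ℕ) : ℝ) ^ 2 / 4 * (2 * α₀) ≤ 1 / 24)
    (hαL' : 157 * (((((F.P K).d + 2) * (F.P K).L : ℕ) : ℝ) ^ 2 / 4 * (2 * α₀)) < (((F.P K).L : ℝ) ^ ((F.P K).d - 1))⁻¹)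
    (hε₀ : 0 ≤ ν.ε₀) (hGFnum : ((((F.P K).d * (F.P K).L : ℕ) : ℝ)) ^ 2 / 4 * ν.ε₀ < deltaFed (Fin N))
    (h11 : ∀ j, j ≤ K → ∀ V ∈ domAltOfRecord F N ν K j, UkExists F N K j εbg V ∧ UniqueUkOrbit F N K j εbg V)
    (hreg8 : ∀ j, j ≤ K → ∀ V ∈ domAltOfRecord F N ν K j, Uk F N K j εbg V ∈ bgReg F N K j ν.εreg)
    (hρm : ∀ j < K, Measurable (betaInputOfRecord F N (TcanOfRecord F N) (chiFixed29Ax F N ν ε₁) K g j))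
    (hint : ∀ j < K, Integrable (betaInputOfRecord F N (TcanOfRecord F N) (chiFixed29Ax F N ν ε₁) K g j) (fieldMeasure (F.P K) j (SU N))) :
    ∀ j, j ≤ K → ContinuousOn (effActionHT F N (TcanOfRecord F N) (chiFixed29Ax F N ν ε₁) K g j) (domAltOfRecord F N ν K j)
  | 0, _ => continuousOn_effActionHT_zero _ _ K g _
  | j + 1, hj => by
    have hjK : j < K := Nat.lt_of_succ_le hj
    have ih := continuousOn_effActionHT_chi29Ax_all_of_thm1_of_numerics hε1 hα24 hαδ hαL hεreg hε3 hε2 hn1 hn2 hαB hord hlt he hα0 hα3 hα2 hα24' hαL'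
      hε₀ hGFnum h11 hreg8 hρm hint j hjK.le
    exact (hregAx_pos_contA_of_thm1_of_numerics ν εbg K g hjK hε1 hα24 hαδ hαL hεreg hε3 hε2 hn1 hn2 hαB hord hlt he hα0 hα3 hα2 hα24' hαL' hε₀ hGFnum
      h11 hreg8 (hρm j hjK) (hint j hjK) ih).2.2

/-- ★★★ **… HENCE, FOR EVERY `j < K`: `hreg_j`, the on-domain proviso `HasContTransportOn … ρ_j^{Ax} domAlt_{j+1}`, AND (F3)_j** — ROAD B FOR THE Ax RECORD modulo [B11]'s two-radii binders,
the (H-U)∕(I19) level families and numerics. [cite: Balaban1987RG1, p.259, (0.13) p.254, (0.19) p.255 and (2.10) p.267; Balaban1985Variational, Thm 1 (8) p.279] -/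
theorem hregAx_pos_all_of_thm1_of_numerics
    (hε1 : 0 < ε₁) {α : ℝ} (hα24 : α ≤ 1 / 24) (hαδ : α < deltaSU (Fin N)) (hαL : 157 * α < (((F.P K).L : ℝ) ^ ((F.P K).d - 1))⁻¹)
    (hεreg : 0 < ν.εreg)
    (hε3 : (143 * (((((F.P K).d + 4 : ℕ) : ℝ)) ^ 2 / 4) ^ 2) * ν.εreg ≤ 1 / 3)
    (hε2 : 2 * ν.εreg ≤ 2 * deltaSU (Fin N) / ((((F.P K).d + 4) * (F.P K).L : ℕ) : ℝ) ^ 2)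
    (hn1 : 1640 * (2 * (((((F.P K).d + 2) * (F.P K).L : ℕ) : ℝ) * ε₁) + ((((F.P K).d + 2) * (F.P K).L : ℕ) : ℝ) ^ 2 / 4 * (2 * ν.εreg / ((F.P K).L : ℝ) ^ 2)) *
      (((F.P K).L : ℝ) ^ ((F.P K).d - 1)) ^ 2 ≤ 1)
    (hn2 : 13 * (2 * (((((F.P K).d + 2) * (F.P K).L : ℕ) : ℝ) * ε₁) + ((((F.P K).d + 2) * (F.P K).L : ℕ) : ℝ) ^ 2 / 4 * (2 * ν.εreg / ((F.P K).L : ℝ) ^ 2)) *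
      ((F.P K).L : ℝ) ^ ((F.P K).d - 1) < deltaSU (Fin N))
    (hαB : ((((F.P K).d + 2) * (F.P K).L : ℕ) : ℝ) ^ 2 / 4 *
      (2 * ν.εreg / ((F.P K).L : ℝ) ^ 2 + 4 * max ε₁ (10 * (((((F.P K).d + 2) * (F.P K).L : ℕ) : ℝ) * ε₁) * ((F.P K).L : ℝ) ^ ((F.P K).d - 1))) < α)
    (hord : 2 * ν.εreg / ((F.P K).L : ℝ) ^ 2 + 4 * max ε₁ (10 * (((((F.P K).d + 2) * (F.P K).L : ℕ) : ℝ) * ε₁) * ((F.P K).L : ℝ) ^ ((F.P K).d - 1)) < ν.ε₀)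
    {α₀ : ℝ} (hlt : ν.εreg < εbg) (he : ν.εreg < α₀) (hα0 : 0 < α₀)
    (hα3 : (143 * (((((F.P K).d + 4 : ℕ) : ℝ)) ^ 2 / 4) ^ 2) * α₀ ≤ 1 / 3)
    (hα2 : 2 * α₀ ≤ 2 * deltaSU (Fin N) / ((((F.P K).d + 4) * (F.P K).L : ℕ) : ℝ) ^ 2)
    (hα24' : ((((F.P K).d + 2) * (F.P K).L : ℕ) : ℝ) ^ 2 / 4 * (2 * α₀) ≤ 1 / 24)
    (hαL' : 157 * (((((F.P K).d + 2) * (F.P K).L : ℕ) : ℝ) ^ 2 / 4 * (2 * α₀)) < (((F.P K).L : ℝ) ^ ((F.P K).d - 1))⁻¹)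
    (hε₀ : 0 ≤ ν.ε₀) (hGFnum : ((((F.P K).d * (F.P K).L : ℕ) : ℝ)) ^ 2 / 4 * ν.ε₀ < deltaFed (Fin N))
    (h11 : ∀ j, j ≤ K → ∀ V ∈ domAltOfRecord F N ν K j, UkExists F N K j εbg V ∧ UniqueUkOrbit F N K j εbg V)
    (hreg8 : ∀ j, j ≤ K → ∀ V ∈ domAltOfRecord F N ν K j, Uk F N K j εbg V ∈ bgReg F N K j ν.εreg)
    (hρm : ∀ j < K, Measurable (betaInputOfRecord F N (TcanOfRecord F N) (chiFixed29Ax F N ν ε₁) K g j))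
    (hint : ∀ j < K, Integrable (betaInputOfRecord F N (TcanOfRecord F N) (chiFixed29Ax F N ν ε₁) K g j) (fieldMeasure (F.P K) j (SU N))) :
    ∀ j < K, (domAltOfRecord F N ν K (j + 1) ⊆ regSetOfRecord F N K j (betaInputOfRecord F N (TcanOfRecord F N) (chiFixed29Ax F N ν ε₁) K g j) ∧
        HasContTransportOn F N K j (betaInputOfRecord F N (TcanOfRecord F N) (chiFixed29Ax F N ν ε₁) K g j) (domAltOfRecord F N ν K (j + 1))) ∧
      ∀ V ∈ domAltOfRecord F N ν K (j + 1), 0 < TcanOfRecord F N K j (betaInputOfRecord F N (TcanOfRecord F N) (chiFixed29Ax F N ν ε₁) K g j) V := by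
  intro j hj
  have h := hregAx_pos_contA_of_thm1_of_numerics ν εbg K g hj hε1 hα24 hαδ hαL hεreg hε3 hε2 hn1 hn2 hαB hord hlt he hα0 hα3 hα2 hα24' hαL' hε₀ hGFnum h11 hreg8
    (hρm j hj) (hint j hj)
    (continuousOn_effActionHT_chi29Ax_all_of_thm1_of_numerics ν εbg K g hε1 hα24 hαδ hαL hεreg hε3 hε2 hn1 hn2 hαB hord hlt he hα0 hα3 hα2 hα24' hαL' hε₀ hGFnum
      h11 hreg8 hρm hint j hj.le)
  exact ⟨h.1, h.2.1⟩

end Tower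

end Summit.QuantumFields.YangMills.BalabanUVNodes.N07RegularityTowerChi29AxOfThm1
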